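import Summits.ABC.ABC.Theses.DefiniteXi
import Summits.ABC.ABC.Theses.IsogenyGlueCongruence
import Summits.ABC.ABC.Theorems.IsogenyGlueCongruenceMazurKenkuBoundOfRadius
import Literature.NumberTheory.EllipticCurves.PastenSpectralDegree
import Literature.NumberTheory.EllipticCurves.ManinConstantArbitraryParametrizationIntegralProofs
import Literature.NumberTheory.EllipticCurves.PastenHeightBoundsLemma68LocalProofs
import Literature.NumberTheory.EllipticCurves.CyclicIsogenyCharacterFrobeniusProofs
import Literature.NumberTheory.EllipticCurves.RationalIsogenyFrobeniusCriterionPrimePower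
import Literature.NumberTheory.EllipticCurves.OpenImageMazurCharacterProofs
import Literature.NumberTheory.EllipticCurves.OpenImageMazurNumericsProofs
import Literature.NumberTheory.EllipticCurves.CyclicIsogenyFortyNineMiddleCurveProofs
import Literature.NumberTheory.EllipticCurves.IsogenyFrobeniusTraceProofs
import Literature.NumberTheory.EllipticCurves.SemistableModPImageMultiplicativeProofs
import HarnessLib

/-!
# STUB-IDEAS k3 (generation 2) scratch — `stub_pasten163` (crux `DefiniteRTControlPrime`, stmt-ABC-11338)

Helper statements for `STUB-IDEAS-stub_pasten163-3.md` (gen 2, FAMILY 3 — probe the extremes).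
Plan A helpers are PROVED one-liners (bridges by name).  Plan B is the exact extremal accounting
(proved arithmetic identities).  Plan C helpers are SIGNATURES (`sorry`) — the decomposition of the
one new lemma of the Mazur-free reshape (ideator-1's H5) into tree-adjacent pieces at prime-power
level.  Nothing here is proposed to the tree; quick-elaboration sanity only.
-/

set_option linter.dupNamespace false

noncomputable section

open scoped Classical
open NumberField IsDedekindDomain IsDedekindDomain.HeightOneSpectrum Field WeierstrassCurve

namespace Summit.ABC.ABC.Cruxes.DefiniteRTControlPrime.StubIdeas3g2

open Literature.NumberTheory.EllipticCurves Literature.NumberTheory.EllipticCurves.ModularForms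
open Literature.NumberTheory.GaloisRepresentations

/-! ## Plan A — import by name (the stub IS route item `MazurKenkuBound`, stmt-ABC-15125) -/

/-- A1: the stub's type is verbatim the body of the STAFFED item
`IsogenyGlueCongruence.MazurKenkuBound` (stmt-ABC-15125, skeleton eb1cbf69) and of this route's
aside copy `DefiniteXi.MazurKenkuBound`. -/
theorem A1_stub_iff_item :
    (PastenShimura2024_minimalDegree_le_163_mul ↔
        Summit.ABC.ABC.Theses.IsogenyGlueCongruence.MazurKenkuBound) ∧
      (PastenShimura2024_minimalDegree_le_163_mul ↔
        Summit.ABC.ABC.Theses.DefiniteXi.MazurKenkuBound) :=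
  ⟨Iff.rfl, Iff.rfl⟩

/-- A2: the stub from the radius item (stmt-ABC-15193), landed glue p102678. -/
theorem A2_stub_of_radiusItem (hRad : Summit.ABC.ABC.Theses.DefiniteXi.MazurKenkuRadius) :
    PastenShimura2024_minimalDegree_le_163_mul :=
  Summit.ABC.ABC.Theorems.mazurKenkuBound_of_radiusItem hRad

/-- A3: the stub from the Literature named fact (Mazur 1978 Thm 1 + Kenku 1982, list form). -/
theorem A3_stub_of_mazurKenku (hMK : mazurKenku_exists_cyclic_isogeny) :
    PastenShimura2024_minimalDegree_le_163_mul :=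
  PastenShimura2024_minimalDegree_le_163_mul_of_mazurKenku' hMK

/-! ## Plan B — exact extremal accounting: the two Pasten stubs are ONE quantity `d`

Variables of the skeleton's Frey configuration at an odd prime `q ∣ N`:
`δ0` = degree of the optimal datum `D₀`, `δF` = minimal degree of the (minimal model of the) Frey
curve, `d` = degree of the cyclic `ℚ`-isogeny `W₀ → W_F`, `h = ξ(N/q,q)`, `i·j = c0 = ord_q Δ_min(W₀)`
(Takahashi 2.3: `δ0·i = h·j`), `cF = ord_q Δ_min(W_F)`, and `c0·b = cF·a` with `a·b ∣ d` (tree: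
`exists_ordMinimalDiscriminant_mul_eq_mul_of_isCyclic`). -/

/-- B1 (proved): the exact identity `δF·b·i² = d·a·h·cF`. -/
theorem B1_degree_identity {δ0 δF i j h c0 cF d a b : ℕ} (h1 : δ0 * i = h * j)
    (h2 : i * j = c0) (h3 : δF = d * δ0) (h4 : c0 * b = cF * a) :
    δF * b * i ^ 2 = d * a * h * cF := by
  subst h3 h2
  have e1 : d * δ0 * b * i ^ 2 = d * b * i * (δ0 * i) := by ring
  rw [e1, h1]
  have e2 : d * b * i * (h * j) = d * h * (i * j * b) := by ring
  rw [e2, h4]; ring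

/-- B2 (proved): hence `δF ≤ d·a·(h·cF) ≤ d²·(h·cF)` — only the `q`-ÉTALE share `a` of the cyclic
kernel is paid; a kernel toric at `q` (`a = 1`) costs `d`, not `d²`; Lemma 6.8 is not a separate
input. -/
theorem B2_degree_le {δ0 δF i j h c0 cF d a b : ℕ} (h1 : δ0 * i = h * j)
    (h2 : i * j = c0) (h3 : δF = d * δ0) (h4 : c0 * b = cF * a) (hb : 0 < b) (hi : 0 < i)
    (had : a ≤ d) : δF ≤ d ^ 2 * (h * cF) := by
  have hid := B1_degree_identity h1 h2 h3 h4
  have hbi : 0 < b * i ^ 2 := by positivity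
  calc δF ≤ δF * (b * i ^ 2) := Nat.le_mul_of_pos_right _ hbi
    _ = d * a * h * cF := by rw [← hid]; ring
    _ ≤ d * d * h * cF := by gcongr
    _ = d ^ 2 * (h * cF) := by ring

/-! ## Plan C — Family-3 autopsy of the ONE new lemma of the Mazur-free reshape

"A minimal counterexample forces structure": a Frey class with a cyclic isogeny of large odd
prime-power degree `p^(2m)` has a MIDDLE curve whose `p^m`-torsion splits into two `Γ_ℚ`-stable
cyclic lines; the split forces the local shape of the two characters at every place (C2a/C2b),
Minkowski rigidifies them globally (C3), and one good Frobenius turns this into the divisibility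
`p^m ∣ #Ẽ(𝔽_{ℓ^n})` (C4); counting (C5) gives `d_odd ∣ (n(ℓ₀) n(ℓ₁))³ = N^{o(1)}`. -/

/-- C1 (pattern: the PROVED `middleSeven`, 7 ↦ p, 49 ↦ p^(2m)): the middle curve of a cyclic
`p^(2m)`-isogeny carries two independent `Γ_ℚ`-stable cyclic lines of order `p^m`. -/
theorem C1_exists_splitMiddle (p m : ℕ) [Fact p.Prime] :
    ∀ (V V' : WeierstrassCurve ℚ) [V.IsElliptic] [V'.IsElliptic] (ψ : Isogeny V V'),
      ψ.IsCyclic → ψ.degree = p ^ (2 * m) →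
      ∃ (V₁ : WeierstrassCurve ℚ) (_ : V₁.IsElliptic), IsIsogenous V V₁ ∧
        ∃ (P₁ P₂ : V₁.geomPoints), addOrderOf P₁ = p ^ m ∧ addOrderOf P₂ = p ^ m ∧
          (∀ σ : absoluteGaloisGroup ℚ, σ • P₁ ∈ AddSubgroup.zmultiples P₁) ∧
          (∀ σ : absoluteGaloisGroup ℚ, σ • P₂ ∈ AddSubgroup.zmultiples P₂) ∧
          AddSubgroup.zmultiples P₁ ⊓ AddSubgroup.zmultiples P₂ = ⊥ := by
  sorry

/-- C2a (local, multiplicative `v ∤ p`, level `p^m`; pattern: the level-`p` transvection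
`exists_addSubgroup_card_le_of_hasMultiplicativeReductionAt` / `MultiplicativeTransvectionPrimeToV`,
Tate curve `E[p^m] = ⟨ζ, q^{1/p^m}⟩`): an inertia-FIXED point `X` of exact order `p^m` with
`(τ - 1)·E[p^m] ⊆ ℤX`.  WARNING (dead end recorded): the weaker unipotence `(τ-1)² = 0`
(`smul_smul_sub_eq_of_mem_inertia_geomPoints`) only yields `r ≡ 1 mod p^⌈m/2⌉` below. -/
theorem C2a_tateShape_primePow (W : WeierstrassCurve ℚ) [W.IsElliptic] {p : ℕ} [Fact p.Prime]
    (m : ℕ) {v : HeightOneSpectrum (𝓞 ℚ)} (hpv : (p : 𝓞 ℚ) ∉ v.asIdeal)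
    (hmult : W.HasMultiplicativeReductionAt v)
    {𝔓 : Ideal (absIntegers (𝓞 ℚ) ℚ)} (h𝔓 : 𝔓 ∈ v.primesAbove) :
    ∃ X : geomPoints W, addOrderOf X = p ^ m ∧
      (∀ τ ∈ 𝔓.inertia (absoluteGaloisGroup ℚ), τ • X = X) ∧
      ∀ τ ∈ 𝔓.inertia (absoluteGaloisGroup ℚ), ∀ R : geomPoints W, ((p ^ m : ℕ) : ℤ) • R = 0 →
        τ • R - R ∈ AddSubgroup.zmultiples X := by
  sorry

/-- C2a' (5 lines of linear algebra over `ℤ/p^m` from C2a): if `E[p^m] = ℤP ⊕ ℤQ` with BOTH lines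
`Γ_ℚ`-stable, inertia at a multiplicative `v ∤ p` acts TRIVIALLY on the character of `P`
(write `X = αP + βQ`; `α` or `β` is a unit; `τX = X` and `(τ-1)P, (τ-1)Q ∈ ℤX` force
`r(τ) = s(τ) = 1`).  Equivalently `p^m ∣ ord_v Δ_min` at every such `v`. -/
theorem C2a'_char_eq_one_of_split (W : WeierstrassCurve ℚ) [W.IsElliptic] {p : ℕ} [Fact p.Prime]
    {m : ℕ} {v : HeightOneSpectrum (𝓞 ℚ)} (hpv : (p : 𝓞 ℚ) ∉ v.asIdeal)
    (hmult : W.HasMultiplicativeReductionAt v)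
    {𝔓 : Ideal (absIntegers (𝓞 ℚ) ℚ)} (h𝔓 : 𝔓 ∈ v.primesAbove)
    {P Q : geomPoints W} (hP : addOrderOf P = p ^ m) (hQ : addOrderOf Q = p ^ m)
    (hPQ : AddSubgroup.zmultiples P ⊓ AddSubgroup.zmultiples Q = ⊥)
    (hstQ : ∀ σ : absoluteGaloisGroup ℚ, σ • Q ∈ AddSubgroup.zmultiples Q)
    {r : absoluteGaloisGroup ℚ →* (ZMod (p ^ m))ˣ}
    (hr : ∀ σ : absoluteGaloisGroup ℚ, σ • P = ((r σ : (ZMod (p ^ m))ˣ) : ZMod (p ^ m)).val • P)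
    {τ : absoluteGaloisGroup ℚ} (hτ : τ ∈ 𝔓.inertia (absoluteGaloisGroup ℚ)) : r τ = 1 := by
  sorry

/-- C2b (local at `p` itself, `p` odd, semistable at `p`, level `p^m`, `0 < m`): with the split as in
C2a', the character of `P` on inertia above `p` is EXACTLY `1` or EXACTLY `χ̄_{p^m}` (shape
`(χ *; 0 1)` on `E[p^m]` — Tate curve if multiplicative, height-one formal group + unramified
`Ẽ[p^m]` if ordinary; supersingular is excluded by the existence of a stable line,
`isCyclic_and_card_inertia_map_of_dvd_frobeniusTrace`).  Replaces Mazur's Lemma 5.2 at level `p^m`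
(no local Kronecker–Weber needed). -/
theorem C2b_char_at_p_of_split (W : WeierstrassCurve ℚ) [W.IsElliptic] {p : ℕ} [Fact p.Prime]
    (hp2 : p ≠ 2) {m : ℕ} (hm : 0 < m) {v : HeightOneSpectrum (𝓞 ℚ)} (hpv : (p : 𝓞 ℚ) ∈ v.asIdeal)
    (hss : W.HasGoodReductionAt v ∨ W.HasMultiplicativeReductionAt v)
    {𝔓 : Ideal (absIntegers (𝓞 ℚ) ℚ)} (h𝔓 : 𝔓 ∈ v.primesAbove)
    {P Q : geomPoints W} (hP : addOrderOf P = p ^ m) (hQ : addOrderOf Q = p ^ m)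
    (hPQ : AddSubgroup.zmultiples P ⊓ AddSubgroup.zmultiples Q = ⊥)
    (hstP : ∀ σ : absoluteGaloisGroup ℚ, σ • P ∈ AddSubgroup.zmultiples P)
    (hstQ : ∀ σ : absoluteGaloisGroup ℚ, σ • Q ∈ AddSubgroup.zmultiples Q)
    {r : absoluteGaloisGroup ℚ →* (ZMod (p ^ m))ˣ}
    (hr : ∀ σ : absoluteGaloisGroup ℚ, σ • P = ((r σ : (ZMod (p ^ m))ˣ) : ZMod (p ^ m)).val • P) :
    (∀ τ ∈ 𝔓.inertia (absoluteGaloisGroup ℚ), r τ = 1) ∨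
      (∀ τ ∈ 𝔓.inertia (absoluteGaloisGroup ℚ), r τ = modNCyclotomicCharacter ℚ (p ^ m) τ) := by
  sorry

/-- C3 (global, Minkowski normal form at PRIME-POWER level; pattern: the second half of
`Mazur1978.exists_forall_eq_mul_modNCyclotomicCharacter_pow` verbatim with `N ↦ p^m`, the
inertia-at-`p` exponent `κ` being an INPUT (from C2b) instead of Lemma 5.2's output):
`r = b · χ̄_{p^m}^κ` with `b^n = 1` pointwise. -/
theorem C3_normalForm (p m : ℕ) [Fact p.Prime] [NeZero (p ^ m)]
    (r : absoluteGaloisGroup ℚ →* (ZMod (p ^ m))ˣ)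
    (hker : IsOpen ((r.ker : Subgroup (absoluteGaloisGroup ℚ)) : Set (absoluteGaloisGroup ℚ)))
    {n : ℕ} (κ : ℕ)
    (hloc : ∀ (v : HeightOneSpectrum (𝓞 ℚ)), (p : 𝓞 ℚ) ∉ v.asIdeal → ∀ 𝔓 ∈ v.primesAbove,
      ∀ τ ∈ 𝔓.inertia (absoluteGaloisGroup ℚ), r τ ^ n = 1)
    (hp : ∀ (v : HeightOneSpectrum (𝓞 ℚ)), (p : 𝓞 ℚ) ∈ v.asIdeal → ∀ 𝔓 ∈ v.primesAbove,
      ∀ τ ∈ 𝔓.inertia (absoluteGaloisGroup ℚ), r τ = modNCyclotomicCharacter ℚ (p ^ m) τ ^ κ) :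
    ∀ σ : absoluteGaloisGroup ℚ, ∃ b : (ZMod (p ^ m))ˣ, b ^ n = 1 ∧
      r σ = b * modNCyclotomicCharacter ℚ (p ^ m) σ ^ κ := by
  sorry

/-- C4 (one good Frobenius; pattern: `Mazur1978.exists_root_charpoly_mod_of_cyclicCharacter`
(IN TREE, level `p^k`) + the Lucas identity `x^n + y^n = V_n(x+y, xy)`): with `x = r(Frob_ℓ)` a root
of `X² - a_ℓ X + ℓ` in `ℤ/p^m` and `x^n = ℓ^{nκ}`, `κ ≤ 1`, one gets
`(1 - x^n)(1 - y^n) = 0`, i.e. `p^m ∣ 1 + ℓ^n - V_n(a_ℓ, ℓ) = #Ẽ(𝔽_{ℓ^n})`. -/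
theorem C4_primePow_dvd_pointCount (W : WeierstrassCurve ℚ) [W.IsElliptic] [W.IsGloballyMinimal]
    (p m ℓ n κ : ℕ) [Fact p.Prime] [Fact ℓ.Prime] [NeZero (p ^ m)] (hℓp : ℓ ≠ p)
    (hgood : W.HasGoodReductionAtPrime ℓ) (hκ : κ ≤ 1)
    {P : geomPoints W} (hP : addOrderOf P = p ^ m)
    {r : absoluteGaloisGroup ℚ →* (ZMod (p ^ m))ˣ}
    (hr : ∀ σ : absoluteGaloisGroup ℚ, σ • P = ((r σ : (ZMod (p ^ m))ˣ) : ZMod (p ^ m)).val • P)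
    (hnf : ∀ σ : absoluteGaloisGroup ℚ, ∃ b : (ZMod (p ^ m))ˣ, b ^ n = 1 ∧
      r σ = b * modNCyclotomicCharacter ℚ (p ^ m) σ ^ κ) :
    ((p : ℤ) ^ m) ∣ 1 + (ℓ : ℤ) ^ n - Mazur1978.frobTracePow (W.frobeniusTrace ℓ) ℓ n := by
  sorry

/-- C5 (proved counting): radical AND half-exponents of `d` divide `n` ⇒ `d ∣ n³`. -/
theorem C5_dvd_cube {d n : ℕ} (hd : 0 < d) (hn : 0 < n)
    (h : ∀ p : ℕ, p.Prime → p ∣ d → p ^ max 1 (d.factorization p / 2) ∣ n) : d ∣ n ^ 3 := by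
  rw [← Nat.factorization_le_iff_dvd hd.ne' (pow_pos hn 3).ne', Nat.factorization_pow]
  intro p
  by_cases hp : p.Prime
  · by_cases hpd : p ∣ d
    · have h1 := h p hp hpd
      have h2 : max 1 (d.factorization p / 2) ≤ n.factorization p := by
        rwa [← hp.pow_dvd_iff_le_factorization hn.ne']
      simp only [Finsupp.smul_apply, smul_eq_mul]
      omega
    · simp [Nat.factorization_eq_zero_of_not_dvd hpd]
  · simp [Nat.factorization_eq_zero_of_not_prime d hp]

/-- The reshaped target these pieces assemble to (ideator-1's `FreyIsogenyDiameter`, exponent part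
made explicit): for a curve semistable away from `2`, the odd part of any cyclic isogeny degree out of
it divides `(n(ℓ₀)·n(ℓ₁))³`, `n(ℓ) = #Ẽ(𝔽_{ℓ^24})`, for any two distinct odd good primes. -/
def OddCyclicDegreeDvdPointCounts : Prop :=
  ∀ (V V' : WeierstrassCurve ℚ) [V.IsElliptic] [V'.IsElliptic] [V.IsGloballyMinimal]
    (ψ : Isogeny V V'), ψ.IsCyclic →
    (∀ v : HeightOneSpectrum (𝓞 ℚ), (2 : 𝓞 ℚ) ∉ v.asIdeal →
      V.HasGoodReductionAt v ∨ V.HasMultiplicativeReductionAt v) →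
    ∀ (ℓ₀ ℓ₁ : ℕ) [Fact ℓ₀.Prime] [Fact ℓ₁.Prime], ℓ₀ ≠ 2 → ℓ₁ ≠ 2 → ℓ₀ ≠ ℓ₁ →
      V.HasGoodReductionAtPrime ℓ₀ → V.HasGoodReductionAtPrime ℓ₁ →
      ψ.degree / 2 ^ (ψ.degree.factorization 2) ∣
        ((1 + (ℓ₀ : ℤ) ^ 24 - Mazur1978.frobTracePow (V.frobeniusTrace ℓ₀) ℓ₀ 24).natAbs *
          (1 + (ℓ₁ : ℤ) ^ 24 - Mazur1978.frobTracePow (V.frobeniusTrace ℓ₁) ℓ₁ 24).natAbs) ^ 3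

/-- C0: the assembly C1–C5 ⇒ the reshaped target (bookkeeping over the primes of `d`; `p = ℓ₀` is
served by `ℓ₁`). -/
theorem C0_oddCyclicDegreeDvdPointCounts : OddCyclicDegreeDvdPointCounts := by
  sorry

end Summit.ABC.ABC.Cruxes.DefiniteRTControlPrime.StubIdeas3g2

end
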